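import Mathlib.Analysis.SpecialFunctions.ImproperIntegrals
import Literature.NumberTheory.LFunctions.XiIntegralLimitProofs
import HarnessLib

/-!
# The integral of Riemann's `ξ`-function: the rate `Ξ₀^{(-1)}(t) = A₀ + O(t^{-2/3})` — proof

Literature/NumberTheory/LFunctions. Companion ("Proofs") file of `XiIntegral.lean`, on top of
`XiIntegralLimitProofs.lean` (Thm. 2.1 (1): `∫₀^∞ Ξ = A₀`, `ξ^{(-1)}(½+it) = i∫₀ᵗ Ξ`, decay and integrability of
`Ξ(t) = ξ(½ + it)`), discharging the named fact
`Literature.NumberTheory.LFunctions.LagariasMontague2011_thm_2_1_i_rate` — Lagarias–Montague 2011, eq. (2.3) in the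
proof of Thm. 2.1 (1), case `λ = 0`:

  `‖ξ^{(-1)}(½ + it) − iA₀‖ ≤ C t^{−2/3}`  for `t ≥ 3`,   `A₀ = πΦ_T(0) = 2π·deBruijnPhi 0 = xiIntegralLimit`.

## The printed proof and the proof given here

Lagarias–Montague (§4, p. 11 of arXiv:1106.4348) prove (2.3) for the whole family
`Ξ_λ^{(-1)}(t) = 2∫₀^∞ e^{λu²}Φ(u) sin(tu)/u du`: substitute `v = tu`, split `[0, ∞)` at `2π⌊t^{2/3}⌋` and
`2π⌊t^{4/3}⌋`, use `F(u) = Φ(0) + O(u²)` near `0`, the quantitative Dirichlet integral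
`∫₀^{2πT} sin u/u du = π/2 + O(1/T)`, a second-order Taylor estimate on each period in the middle range, and the
super-exponential decay of `Φ` in the tail. For `λ = 0` — the only case vendored — `Ξ₀^{(-1)}(t) = ∫₀ᵗ Ξ`
(LM Lemma 3.2 (3); `xiIntegral_criticalLine`) and `∫₀^∞ Ξ = A₀` (LM Thm. 2.1 (1);
`integral_riemannXi_criticalLine_Ioi`, by Fourier inversion of Lemma 3.1), so

  `ξ^{(-1)}(½ + it) − iA₀ = −i ∫ₜ^∞ Ξ(w) dw`,

and the exponential decay of `Ξ` on the real axis (LM Lemma 3.3 (1) at `σ = ½`; here the tree's Stirling-order form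
`‖ξ(½+iw)‖ ≤ 24π²(1+|w|)⁴e^{−π|w|/4}`, `norm_riemannXi_criticalLine_le`) gives the much stronger
`‖∫ₜ^∞ Ξ‖ ≤ K∫ₜ^∞ e^{−w/4} dw = 4Ke^{−t/4} ≤ 16K t^{−2/3}`. We follow this shorter road (the Dirichlet integral is not
in Mathlib); the exponent `−2/3` of (2.3) is what the general-`λ` method yields and is all that is vendored.

## References

* J. C. Lagarias, D. Montague, *The integral of the Riemann ξ-function*, Comment. Math. Univ. St. Pauli 60 (2011)
  143–169, arXiv:1106.4348: Thm. 2.1 (1) and eq. (2.3) (p. 6), Lemma 3.2 (3), Lemma 3.3 (1) (p. 8), §4 (p. 11).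
  [key LagariasMontague2011]
-/

noncomputable section

open Complex MeasureTheory Real Set
open _root_.Filter
open scoped _root_.Topology

namespace Literature.NumberTheory.LFunctions

/-- Pure exponential decay of `Ξ` on `[2, ∞)`: `‖ξ(½ + iw)‖ ≤ 9216π²e^{1/2} · e^{−w/4}` for `w ≥ 2` — from
`norm_riemannXi_criticalLine_le` (`24π²(1+w)⁴e^{−πw/4}`) with `e^{−πw/4} ≤ e^{−3w/4}` and
`(1+w)⁴ ≤ 4!·2⁴·e^{(1+w)/2}`. (LM Lemma 3.3 (1) on `σ = ½`, polynomial factor absorbed.)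
[cite: LagariasMontague2011, Lemma 3.3 (1)] -/
theorem norm_riemannXi_criticalLine_le_exp_neg {w : ℝ} (hw : 2 ≤ w) :
    ‖riemannXi (1 / 2 + w * I)‖ ≤ 24 * π ^ 2 * (384 * rexp (1 / 2)) * rexp (-(w / 4)) := by
  have hw0 : 0 ≤ w := by linarith
  have h := norm_riemannXi_criticalLine_le (t := w) (by rw [abs_of_nonneg hw0]; exact hw)
  rw [abs_of_nonneg hw0] at h
  have h2 : (1 + w) ^ 4 ≤ 384 * rexp ((1 + w) / 2) := by
    have h3 := Real.pow_div_factorial_le_exp ((1 + w) / 2) (by positivity) 4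
    have h6 : ((1 + w) / 2) ^ 4 / (Nat.factorial 4 : ℝ) = (1 + w) ^ 4 / 384 := by
      rw [show (Nat.factorial 4 : ℝ) = 24 by norm_num [Nat.factorial] ]
      ring
    rw [h6, div_le_iff₀ (by norm_num : (0 : ℝ) < 384)] at h3
    linarith
  have h3 : rexp (-(π * w) / 4) ≤ rexp (-(3 / 4) * w) :=
    Real.exp_le_exp.mpr (by nlinarith [Real.pi_gt_three])
  have h4 : rexp ((1 + w) / 2) * rexp (-(3 / 4) * w) = rexp (1 / 2) * rexp (-(w / 4)) := by
    rw [← Real.exp_add, ← Real.exp_add]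
    congr 1
    ring
  calc ‖riemannXi (1 / 2 + w * I)‖ ≤ 24 * π ^ 2 * (1 + w) ^ 4 * rexp (-(π * w) / 4) := h
    _ ≤ 24 * π ^ 2 * (384 * rexp ((1 + w) / 2)) * rexp (-(3 / 4) * w) :=
        mul_le_mul (mul_le_mul_of_nonneg_left h2 (by positivity)) h3 (by positivity) (by positivity)
    _ = 24 * π ^ 2 * 384 * (rexp ((1 + w) / 2) * rexp (-(3 / 4) * w)) := by ring
    _ = 24 * π ^ 2 * (384 * rexp (1 / 2)) * rexp (-(w / 4)) := by rw [h4]; ring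

/-- For `t ≥ 1`: `e^{−t/4} ≤ 4 t^{−2/3}` (`t^{2/3} ≤ t ≤ 4e^{t/4}`). [folklore] -/
theorem exp_neg_div_four_le_rpow {t : ℝ} (ht : 1 ≤ t) : rexp (-(t / 4)) ≤ 4 * t ^ (-(2 : ℝ) / 3) := by
  have ht0 : 0 < t := by linarith
  have h1 : t ^ ((2 : ℝ) / 3) ≤ t := by
    conv_rhs => rw [← Real.rpow_one t]
    exact Real.rpow_le_rpow_of_exponent_le ht (by norm_num)
  have h2 : t ≤ 4 * rexp (t / 4) := by have := Real.add_one_le_exp (t / 4); linarith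
  have hpow : t ^ (-(2 : ℝ) / 3) = (t ^ ((2 : ℝ) / 3))⁻¹ := by
    rw [← Real.rpow_neg ht0.le]; norm_num
  rw [hpow, Real.exp_neg, inv_eq_one_div, inv_eq_one_div, mul_one_div, div_le_div_iff₀ (Real.exp_pos _)
    (Real.rpow_pos_of_pos ht0 _)]
  nlinarith [Real.rpow_pos_of_pos ht0 ((2 : ℝ) / 3)]

/-- The tail form of Thm. 2.1 (1): for `t ≥ 0`, `ξ^{(-1)}(½ + it) − iA₀ = −i∫ₜ^∞ ξ(½ + iw) dw`
(`ξ^{(-1)}(½+it) = i∫₀ᵗ Ξ`, `∫₀^∞ Ξ = A₀`). [cite: LagariasMontague2011, Thm. 2.1 (1)] -/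
theorem xiIntegral_criticalLine_sub_limit {t : ℝ} (ht : 0 ≤ t) :
    xiIntegral (1 / 2 + t * I) - (xiIntegralLimit : ℂ) * I = -(I * ∫ w in Ioi t, riemannXi (1 / 2 + w * I)) := by
  rw [xiIntegral_criticalLine, ← intervalIntegral.integral_Ioi_sub_Ioi integrableOn_riemannXi_criticalLine_Ioi ht,
    integral_riemannXi_criticalLine_Ioi]
  ring

/-- **Discharge** of `Literature.NumberTheory.LFunctions.LagariasMontague2011_thm_2_1_i_rate` (Lagarias–Montague 2011,
eq. (2.3): `Ξ₀^{(-1)}(t) = A₀ + O(t^{−2/3})` for `t ≥ 3`): `‖ξ^{(-1)}(½+it) − iA₀‖ = ‖∫ₜ^∞ Ξ‖ ≤ K∫ₜ^∞ e^{−w/4} dw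
= 4Ke^{−t/4} ≤ 16K t^{−2/3}`, `K = 9216π²e^{1/2}`. [cite: LagariasMontague2011, Thm. 2.1 eq. (2.3)] -/
theorem LagariasMontague2011_thm_2_1_i_rate_holds : LagariasMontague2011_thm_2_1_i_rate := by
  set K : ℝ := 24 * π ^ 2 * (384 * rexp (1 / 2)) with hK
  have hK0 : 0 < K := by rw [hK]; positivity
  refine ⟨16 * K, fun t ht ↦ ?_⟩
  have ht0 : (0 : ℝ) ≤ t := by linarith
  rw [xiIntegral_criticalLine_sub_limit ht0, norm_neg, norm_mul, Complex.norm_I, one_mul]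
  have htail : IntegrableOn (fun w : ℝ ↦ K * rexp (-(1 / 4) * w)) (Ioi t) :=
    (integrableOn_exp_mul_Ioi (by norm_num : -(1 / 4 : ℝ) < 0) t).const_mul K
  calc ‖∫ w in Ioi t, riemannXi (1 / 2 + w * I)‖ ≤ ∫ w in Ioi t, ‖riemannXi (1 / 2 + w * I)‖ :=
        norm_integral_le_integral_norm _
    _ ≤ ∫ w in Ioi t, K * rexp (-(1 / 4) * w) := by
        refine setIntegral_mono_on integrable_riemannXi_criticalLine.norm.integrableOn htail measurableSet_Ioi
          fun w hw ↦ ?_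
        have hx : rexp (-(1 / 4) * w) = rexp (-(w / 4)) := by congr 1; ring
        rw [hx]
        exact norm_riemannXi_criticalLine_le_exp_neg (by linarith [le_of_lt (mem_Ioi.mp hw)])
    _ = 4 * K * rexp (-(t / 4)) := by
        rw [MeasureTheory.integral_const_mul, integral_exp_mul_Ioi (by norm_num : -(1 / 4 : ℝ) < 0)]
        have hx : rexp (-(1 / 4) * t) = rexp (-(t / 4)) := by congr 1; ring
        rw [hx]
        field_simp
    _ ≤ 4 * K * (4 * t ^ (-(2 : ℝ) / 3)) := by gcongr; exact exp_neg_div_four_le_rpow (by linarith)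
    _ = 16 * K * t ^ (-(2 : ℝ) / 3) := by ring

end Literature.NumberTheory.LFunctions

end
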